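/-
Copyright (c) 2026 the pub-hodgecm-mathlib formalisation cell (harness21).  Prover seat hodgecm-mathlib-LH4-p02 (g0): road «S3-ram» (LEAD F0P3a-plan (g13) T12-3 (3);
junction pen F0P3a-p01 (g17), J-PACK v2-iso; F0P3a-p04 (g19)'s offer (b) «REGION FACTS pack»; owner F0P3a-p06 (g15)); 2026-09-02.
-/
import Literature.NumberTheory.Automorphic.UnitaryLatticeTreeIsocelesLevelBoundRamified    -- ★ p847634 (F0P3a-p04 (g19)): «nobody deeper» `not_map_sub_one_le_scaleLattice_pow_succ_of_isoceles`; brings ★ FILE L `latticeGraphIso_root_eq_of_mem_unitaryInt`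
import Literature.NumberTheory.Automorphic.UnitaryLatticeTreeRegionUpClosedRamified         -- ★ (F0P3-p04 (g14)): the ROOT TOKEN `map_sub_one_stdLattice_le_scaleLattice_of_eigenframe`
import Literature.NumberTheory.Automorphic.UnitaryLatticeTreeFixedChildrenShallowerRamified  -- ★ (F0P2-p01 (g15)): `lev_mono_of_le` (the level token is monotone in the exponent)
import Literature.NumberTheory.Automorphic.UnitaryLatticeTreeEngineRowsPartRamified          -- ★ p04 (g19) L3 part 1: the `dep∕hdep` label calculus `lev_pow_of_le_dep`, `not_lev_pow_of_dep_lt`, `dep_eq_of_lev_of_not_lev` (reused, not restated)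
import HarnessLib

/-!
# The lattice graph of a hermitian space — THE ROOT REGION OF THE ISOCELES CONFIGURATION: membership facts in the junction's `dep ∕ hdep` dialect
# (Kottwitz 1986 §3; Rogawski 1990 §4.9; Serre, *Trees* II.1.1)

Topic `NumberTheory/Automorphic`; namespace `Literature.NumberTheory.Automorphic.UnitaryLatticeTree`.  THEOREMS ONLY (no definition, no instance, no notation, no named fact,
no `sorry`); kernel lane `--supports stmt-HodgeConjecture-24833`.  Cell `pub/hodgecm-mathlib` (D-0151), crux H413; road «S3-ram» (Literature seeding, count-neutral); the
(a2) JUNCTION (J★) of the type-(1) ramified row, second wave J-PACK v2-iso (pen F0P3a-p01 (g17), skeleton v7 326c2913e2b823a2): **the «REGION FACTS» pack** (F0P3a-p04 (g19)'s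
offer (b), dealt to this seat by LEAD F0P3a-plan (g13) T12-3 (3)).

THE SETTING (the junction's tokens, `J₀`-model).  `H₀ = antidiag(1,1,1)` on `K³`, `G` the lattice graph, root `r₀ = L₀ = 𝒪³`; `γ ∈ U(σ, H₀)`; for a vertex `w` and `c ∈ K`
write `LEV[w](c)` for `(γ − 1)·w ⊆ c·w` (spelled out below as `w.1.map ((Matrix.toLin' (γ − 1)).restrictScalars 𝒪[K]) ≤ scaleLattice c w.1`), `fix w` for `γ·w = w`
(`latticeGraphIso … γ w = w`) and `SD w` for `IsSelfDualLattice … w.1`.  The junction's DEPTH is an abstract `dep : vertices → ℕ` characterised at the fixed vertices by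
  `hdep : ∀ w, fix w → ∀ e, (e ≤ dep w ↔ e ≤ B ∧ LEV[w](ϖ^e))`      (concretely `dep w = Nat.findGreatest (LEV[w](ϖ^·)) B`),
and the ROOT REGION of the ★ ENGINE ED. 3 (`Rogawski1990.strataVec_total_eq_of_localLaw_of_rootRegion[_of_labels]`, F0P3a-p02 (g17)) is, in the isoceles configuration,
  `R = {v | fix v ∧ SD v ∧ LEV[v](ϖ^{d₀})}`      (taken here through a characterisation binder `hR : ∀ v, v ∈ R ↔ …`, engine style),
with any cap `B ≥ d₀`, `d₀` = the small eigenvalue gap of the ISOCELES EIGEN-DATA `γ = A·diag(s)·A⁻¹` (`A, A⁻¹` integral, `s 1 = 1`, isolated index `i₀`: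
`|s_{i₀} − s_j| = |ϖ|^{d₀}` for `j ≠ i₀`, close pair `|s_j − s_k| ≤ |ϖ|^{d₀+2}`, all `|s_i − 1| ≤ |ϖ|^{d₀}`).

**Contents** (everything the engine's region binders `hrR hRF hRS hRdep` ask for, plus the depth dictionary on and off the region).
* §1 `dep ∕ hdep` bookkeeping for ANY `γ` and ANY cap `B`: `dep_le_cap_of_hdep` (`dep w ≤ B`); the rest of the label calculus (`LEV[w](ϖ^e)` for `e ≤ dep w`,
  `¬LEV[w](ϖ^e)` for `dep w < e ≤ B`, exact depth ⇒ `dep w = e`) is ★ `lev_pow_of_le_dep` ∕ `not_lev_pow_of_dep_lt` ∕ `dep_eq_of_lev_of_not_lev` (F0P3a-p04 (g19),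
  `UnitaryLatticeTreeEngineRowsPartRamified`), cited by name.
* §2 THE REGION through `hR`, cap `B := d₀`, NO eigen-data needed: `rootRegion_subset_fixed` (`R ⊆ F`), `isSelfDualLattice_of_mem_rootRegion` (`SD` on `R`),
  `dep_eq_of_mem_rootRegion_of_hdep` (`v ∈ R ⇒ dep v = d₀`), `mem_rootRegion_iff_dep_eq_of_hdep` (for fixed self-dual `w`: `w ∈ R ↔ dep w = d₀`),
  `dep_lt_of_not_mem_rootRegion_of_hdep` (fixed self-dual `w ∉ R ⇒ dep w < d₀`), `rootRegion_finite_of_fixed_finite`.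
* §3 THE ROOT from the eigenframe (★ root token of F0P3-p04 + ★ `latticeGraphIso_root_eq_of_mem_unitaryInt`): `lev_root_pow_of_eigenframe` (`LEV[r₀](ϖ^{d₀})`),
  `dep_root_eq_of_eigenframe_of_hdep` (`dep r₀ = d₀`), `root_mem_rootRegion_of_eigenframe` (`r₀ ∈ R`).
* §4 THE CAP IS INVISIBLE in the isoceles configuration (★ «nobody deeper» p847634 + ★ `lev_mono_of_le`), for `hdep` at ANY cap `B ≥ d₀`: `le_of_lev_pow_of_isoceles`
  (ANY vertex: `LEV[w](ϖ^e) ⇒ e ≤ d₀`), `dep_le_of_isoceles` (`dep w ≤ d₀`), `le_dep_iff_lev_of_isoceles` (the cap-free dictionary `e ≤ dep w ↔ LEV[w](ϖ^e)`),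
  `not_lev_dep_succ_of_isoceles` (`¬LEV[w](ϖ^{dep w + 1})`: `dep` IS the exact depth), `hdep_cap_of_isoceles` (CAP CHANGE: `hdep` at cap `B` ⇒ `hdep` at cap `d₀`).
* §5 THE PACK `rootRegion_facts_of_isoceles` (cap `B ≥ d₀`) — one statement: `r₀ ∈ R ∧ R ⊆ F ∧ (SD on R) ∧ (dep = d₀ on R) ∧ (2 ≤ dep on R) ∧ (∀ fixed w, dep w ≤ d₀) ∧
  (cap-free dictionary) ∧ (exact depth) ∧ (fixed self-dual: w ∈ R ↔ dep w = d₀) ∧ (fixed self-dual off R: dep w < d₀)`.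
(The complementary engine binder `hRup` «the region is up-closed» is the separate socket S1, ★ `row_regionUpClosed_of_neg` of F0P3-p04.)

HONEST LABEL: HC_CM is proved only modulo the 2 remaining named inputs (hLiu418 24832, h413 24833) until rung 0 closes; nothing printed is asserted here (rooted-tree ∕
valuation-ring bookkeeping); «S3-ram» has no books consequence.

## References
* [Kottwitz1986] R. E. Kottwitz, *Base change for unit elements of Hecke algebras*, Compositio Math. 60 (1986), §3 (levels of the fixed lattices of a congruence element;
  the shell recursion).
* [Rogawski1990] J. D. Rogawski, *Automorphic Representations of Unitary Groups in Three Variables*, Ann. of Math. Stud. 123 (1990), §4.9 pp. 54–56 (the two configurations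
  of a type-(1) torus at a ramified place).
* [Serre1980Trees] J.-P. Serre, *Trees* (1980), Ch. II §1.1 (lattices, levels, distance from a base lattice).
* [BruhatTits1972] F. Bruhat, J. Tits, *Groupes réductifs sur un corps local I*, Publ. Math. IHÉS 41 (1972), §10 (lattice models).
-/

set_option autoImplicit false

noncomputable section

open scoped Valued WithZero Matrix MatrixGroups

namespace Literature.NumberTheory.Automorphic.UnitaryLatticeTree

open Literature.NumberTheory.Automorphic Literature.NumberTheory.Automorphic.HermitianLattice
open Literature.NumberTheory.Automorphic.CartanUnique

variable {K : Type*} [Field K] [Valued K ℤᵐ⁰] {σ : K →+* K} {ϖ : K}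

/-! ## §1 `dep ∕ hdep` bookkeeping (any `γ`, any cap `B`) -/

/-- **The depth never exceeds the cap**: under `hdep` (cap `B`), `dep w ≤ B` at every fixed vertex. [cite: Kottwitz1986, §3] -/
theorem dep_le_cap_of_hdep {γ : unitaryGroupOfForm σ ((StdForm.antidiagonal 3).over K)} {B : ℕ}
    {dep : {M : Submodule 𝒪[K] (Fin 3 → K) // IsVertex σ ϖ ((StdForm.antidiagonal 3).over K) M} → ℕ}
    (hdep : ∀ w : {M : Submodule 𝒪[K] (Fin 3 → K) // IsVertex σ ϖ ((StdForm.antidiagonal 3).over K) M}, latticeGraphIso σ ϖ ((StdForm.antidiagonal 3).over K) γ w = w →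
      ∀ e, e ≤ dep w ↔ e ≤ B ∧ w.1.map ((Matrix.toLin' (((γ : GL (Fin 3) K) : Matrix (Fin 3) (Fin 3) K) - 1)).restrictScalars 𝒪[K]) ≤ scaleLattice (ϖ ^ e) w.1)
    {w : {M : Submodule 𝒪[K] (Fin 3 → K) // IsVertex σ ϖ ((StdForm.antidiagonal 3).over K) M}} (hw : latticeGraphIso σ ϖ ((StdForm.antidiagonal 3).over K) γ w = w) :
    dep w ≤ B :=
  ((hdep w hw (dep w)).1 le_rfl).1

/-! ## §2 The root region through its characterisation binder (cap `B := d₀`; no eigen-data) -/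

/-- **`R ⊆ F`**: every region vertex is `γ`-fixed (the engine's `hRF`). [cite: Kottwitz1986, §3] -/
theorem rootRegion_subset_fixed {γ : unitaryGroupOfForm σ ((StdForm.antidiagonal 3).over K)} {d₀ : ℕ}
    {R : Set {M : Submodule 𝒪[K] (Fin 3 → K) // IsVertex σ ϖ ((StdForm.antidiagonal 3).over K) M}}
    (hR : ∀ v, v ∈ R ↔ latticeGraphIso σ ϖ ((StdForm.antidiagonal 3).over K) γ v = v ∧ IsSelfDualLattice σ ϖ ((StdForm.antidiagonal 3).over K) v.1 ∧
      v.1.map ((Matrix.toLin' (((γ : GL (Fin 3) K) : Matrix (Fin 3) (Fin 3) K) - 1)).restrictScalars 𝒪[K]) ≤ scaleLattice (ϖ ^ d₀) v.1) :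
    R ⊆ {v | latticeGraphIso σ ϖ ((StdForm.antidiagonal 3).over K) γ v = v} :=
  fun v hv => ((hR v).1 hv).1

/-- **`SD` on `R`**: every region vertex is self-dual (the engine's `hRS`). [cite: BruhatTits1972, §10] -/
theorem isSelfDualLattice_of_mem_rootRegion {γ : unitaryGroupOfForm σ ((StdForm.antidiagonal 3).over K)} {d₀ : ℕ}
    {R : Set {M : Submodule 𝒪[K] (Fin 3 → K) // IsVertex σ ϖ ((StdForm.antidiagonal 3).over K) M}}
    (hR : ∀ v, v ∈ R ↔ latticeGraphIso σ ϖ ((StdForm.antidiagonal 3).over K) γ v = v ∧ IsSelfDualLattice σ ϖ ((StdForm.antidiagonal 3).over K) v.1 ∧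
      v.1.map ((Matrix.toLin' (((γ : GL (Fin 3) K) : Matrix (Fin 3) (Fin 3) K) - 1)).restrictScalars 𝒪[K]) ≤ scaleLattice (ϖ ^ d₀) v.1)
    {v : {M : Submodule 𝒪[K] (Fin 3 → K) // IsVertex σ ϖ ((StdForm.antidiagonal 3).over K) M}} (hv : v ∈ R) :
    IsSelfDualLattice σ ϖ ((StdForm.antidiagonal 3).over K) v.1 :=
  ((hR v).1 hv).2.1

/-- **`dep = d₀` on `R`** (cap `B := d₀`): a region vertex carries `LEV(ϖ^{d₀})`, so `d₀ ≤ dep v ≤ d₀`. [cite: Kottwitz1986, §3] -/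
theorem dep_eq_of_mem_rootRegion_of_hdep {γ : unitaryGroupOfForm σ ((StdForm.antidiagonal 3).over K)} {d₀ : ℕ}
    {dep : {M : Submodule 𝒪[K] (Fin 3 → K) // IsVertex σ ϖ ((StdForm.antidiagonal 3).over K) M} → ℕ}
    (hdep : ∀ w : {M : Submodule 𝒪[K] (Fin 3 → K) // IsVertex σ ϖ ((StdForm.antidiagonal 3).over K) M}, latticeGraphIso σ ϖ ((StdForm.antidiagonal 3).over K) γ w = w →
      ∀ e, e ≤ dep w ↔ e ≤ d₀ ∧ w.1.map ((Matrix.toLin' (((γ : GL (Fin 3) K) : Matrix (Fin 3) (Fin 3) K) - 1)).restrictScalars 𝒪[K]) ≤ scaleLattice (ϖ ^ e) w.1)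
    {R : Set {M : Submodule 𝒪[K] (Fin 3 → K) // IsVertex σ ϖ ((StdForm.antidiagonal 3).over K) M}}
    (hR : ∀ v, v ∈ R ↔ latticeGraphIso σ ϖ ((StdForm.antidiagonal 3).over K) γ v = v ∧ IsSelfDualLattice σ ϖ ((StdForm.antidiagonal 3).over K) v.1 ∧
      v.1.map ((Matrix.toLin' (((γ : GL (Fin 3) K) : Matrix (Fin 3) (Fin 3) K) - 1)).restrictScalars 𝒪[K]) ≤ scaleLattice (ϖ ^ d₀) v.1)
    {v : {M : Submodule 𝒪[K] (Fin 3 → K) // IsVertex σ ϖ ((StdForm.antidiagonal 3).over K) M}} (hv : v ∈ R) :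
    dep v = d₀ := by
  obtain ⟨hfix, -, hlev⟩ := (hR v).1 hv
  exact le_antisymm (dep_le_cap_of_hdep hdep hfix) ((hdep v hfix d₀).2 ⟨le_rfl, hlev⟩)

/-- **ON ∕ OFF THE REGION IN DEPTH TERMS** (cap `B := d₀`): a fixed self-dual vertex lies in `R` iff `dep w = d₀`. [cite: Kottwitz1986, §3] -/
theorem mem_rootRegion_iff_dep_eq_of_hdep {γ : unitaryGroupOfForm σ ((StdForm.antidiagonal 3).over K)} {d₀ : ℕ}
    {dep : {M : Submodule 𝒪[K] (Fin 3 → K) // IsVertex σ ϖ ((StdForm.antidiagonal 3).over K) M} → ℕ}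
    (hdep : ∀ w : {M : Submodule 𝒪[K] (Fin 3 → K) // IsVertex σ ϖ ((StdForm.antidiagonal 3).over K) M}, latticeGraphIso σ ϖ ((StdForm.antidiagonal 3).over K) γ w = w →
      ∀ e, e ≤ dep w ↔ e ≤ d₀ ∧ w.1.map ((Matrix.toLin' (((γ : GL (Fin 3) K) : Matrix (Fin 3) (Fin 3) K) - 1)).restrictScalars 𝒪[K]) ≤ scaleLattice (ϖ ^ e) w.1)
    {R : Set {M : Submodule 𝒪[K] (Fin 3 → K) // IsVertex σ ϖ ((StdForm.antidiagonal 3).over K) M}}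
    (hR : ∀ v, v ∈ R ↔ latticeGraphIso σ ϖ ((StdForm.antidiagonal 3).over K) γ v = v ∧ IsSelfDualLattice σ ϖ ((StdForm.antidiagonal 3).over K) v.1 ∧
      v.1.map ((Matrix.toLin' (((γ : GL (Fin 3) K) : Matrix (Fin 3) (Fin 3) K) - 1)).restrictScalars 𝒪[K]) ≤ scaleLattice (ϖ ^ d₀) v.1)
    {w : {M : Submodule 𝒪[K] (Fin 3 → K) // IsVertex σ ϖ ((StdForm.antidiagonal 3).over K) M}} (hw : latticeGraphIso σ ϖ ((StdForm.antidiagonal 3).over K) γ w = w)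
    (hwS : IsSelfDualLattice σ ϖ ((StdForm.antidiagonal 3).over K) w.1) :
    w ∈ R ↔ dep w = d₀ := by
  refine ⟨fun hwR => dep_eq_of_mem_rootRegion_of_hdep hdep hR hwR, fun hde => (hR w).2 ⟨hw, hwS, ?_⟩⟩
  have h := lev_pow_of_le_dep hdep hw le_rfl
  rwa [hde] at h

/-- **OFF THE REGION THE DEPTH DROPS** (cap `B := d₀`): a fixed self-dual vertex outside `R` has `dep w < d₀` (the law hypotheses `v ∉ R` of the ★ engine ED. 3 in
depth terms). [cite: Kottwitz1986, §3] -/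
theorem dep_lt_of_not_mem_rootRegion_of_hdep {γ : unitaryGroupOfForm σ ((StdForm.antidiagonal 3).over K)} {d₀ : ℕ}
    {dep : {M : Submodule 𝒪[K] (Fin 3 → K) // IsVertex σ ϖ ((StdForm.antidiagonal 3).over K) M} → ℕ}
    (hdep : ∀ w : {M : Submodule 𝒪[K] (Fin 3 → K) // IsVertex σ ϖ ((StdForm.antidiagonal 3).over K) M}, latticeGraphIso σ ϖ ((StdForm.antidiagonal 3).over K) γ w = w →
      ∀ e, e ≤ dep w ↔ e ≤ d₀ ∧ w.1.map ((Matrix.toLin' (((γ : GL (Fin 3) K) : Matrix (Fin 3) (Fin 3) K) - 1)).restrictScalars 𝒪[K]) ≤ scaleLattice (ϖ ^ e) w.1)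
    {R : Set {M : Submodule 𝒪[K] (Fin 3 → K) // IsVertex σ ϖ ((StdForm.antidiagonal 3).over K) M}}
    (hR : ∀ v, v ∈ R ↔ latticeGraphIso σ ϖ ((StdForm.antidiagonal 3).over K) γ v = v ∧ IsSelfDualLattice σ ϖ ((StdForm.antidiagonal 3).over K) v.1 ∧
      v.1.map ((Matrix.toLin' (((γ : GL (Fin 3) K) : Matrix (Fin 3) (Fin 3) K) - 1)).restrictScalars 𝒪[K]) ≤ scaleLattice (ϖ ^ d₀) v.1)
    {w : {M : Submodule 𝒪[K] (Fin 3 → K) // IsVertex σ ϖ ((StdForm.antidiagonal 3).over K) M}} (hw : latticeGraphIso σ ϖ ((StdForm.antidiagonal 3).over K) γ w = w)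
    (hwS : IsSelfDualLattice σ ϖ ((StdForm.antidiagonal 3).over K) w.1) (hwR : w ∉ R) :
    dep w < d₀ :=
  lt_of_le_of_ne (dep_le_cap_of_hdep hdep hw) (fun h => hwR ((mem_rootRegion_iff_dep_eq_of_hdep hdep hR hw hwS).2 h))

/-- **`R` is finite when the fixed set is** (`R ⊆ F`; the engine's `sR : Finset` binder is `(hF.subset …).toFinset`). [cite: Kottwitz1986, §3] -/
theorem rootRegion_finite_of_fixed_finite {γ : unitaryGroupOfForm σ ((StdForm.antidiagonal 3).over K)} {d₀ : ℕ}
    {R : Set {M : Submodule 𝒪[K] (Fin 3 → K) // IsVertex σ ϖ ((StdForm.antidiagonal 3).over K) M}}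
    (hR : ∀ v, v ∈ R ↔ latticeGraphIso σ ϖ ((StdForm.antidiagonal 3).over K) γ v = v ∧ IsSelfDualLattice σ ϖ ((StdForm.antidiagonal 3).over K) v.1 ∧
      v.1.map ((Matrix.toLin' (((γ : GL (Fin 3) K) : Matrix (Fin 3) (Fin 3) K) - 1)).restrictScalars 𝒪[K]) ≤ scaleLattice (ϖ ^ d₀) v.1)
    (hF : ({v | latticeGraphIso σ ϖ ((StdForm.antidiagonal 3).over K) γ v = v}).Finite) :
    R.Finite :=
  hF.subset (rootRegion_subset_fixed hR)

/-! ## §3 The root: level `ϖ^{d₀}`, fixed, depth `d₀`, member of the region (eigenframe data) -/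

/-- **THE ROOT TOKEN in the junction's vertex spelling**: for `γ = A·diag(s)·A⁻¹` with `A, A⁻¹` integral and `|s_i − 1| ≤ |ϖ|^{d₀}` (`ϖ` a uniformiser), `LEV[r₀](ϖ^{d₀})`
(★ `map_sub_one_stdLattice_le_scaleLattice_of_eigenframe` at `t = ϖ^{d₀}`). [cite: Kottwitz1986, §3] [cite: Serre1980Trees, II.1.1] -/
theorem lev_root_pow_of_eigenframe (hϖ : Valued.v ϖ = WithZero.exp (-1 : ℤ))
    {γ : unitaryGroupOfForm σ ((StdForm.antidiagonal 3).over K)}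
    (A : GL (Fin 3) K) (hA : IsIntMatrix (A : Matrix (Fin 3) (Fin 3) K)) (hA' : IsIntMatrix ((A⁻¹ : GL (Fin 3) K) : Matrix (Fin 3) (Fin 3) K))
    (s : Fin 3 → K) (hγA : ((γ : GL (Fin 3) K) : Matrix (Fin 3) (Fin 3) K) = (A : Matrix (Fin 3) (Fin 3) K) * Matrix.diagonal s * ((A⁻¹ : GL (Fin 3) K) : Matrix (Fin 3) (Fin 3) K))
    {d₀ : ℕ} (he : ∀ i, Valued.v (s i - 1) ≤ Valued.v ϖ ^ d₀) :
    (⟨stdLattice K 3, 0, isSelfDualLattice_stdLattice_three_of_v hϖ⟩ : {M : Submodule 𝒪[K] (Fin 3 → K) // IsVertex σ ϖ ((StdForm.antidiagonal 3).over K) M}).1.map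
        ((Matrix.toLin' (((γ : GL (Fin 3) K) : Matrix (Fin 3) (Fin 3) K) - 1)).restrictScalars 𝒪[K]) ≤
      scaleLattice (ϖ ^ d₀) (⟨stdLattice K 3, 0, isSelfDualLattice_stdLattice_three_of_v hϖ⟩ : {M : Submodule 𝒪[K] (Fin 3 → K) // IsVertex σ ϖ ((StdForm.antidiagonal 3).over K) M}).1 :=
  map_sub_one_stdLattice_le_scaleLattice_of_eigenframe A hA hA' s hγA (pow_ne_zero _ (uniformizer_ne_zero hϖ)) (fun i => by rw [map_pow]; exact he i)

/-- **`dep r₀ = d₀`** (cap `B := d₀`): the root is fixed by `γ ∈ K₀` (★ `latticeGraphIso_root_eq_of_mem_unitaryInt`) and carries `LEV(ϖ^{d₀})` (§3 root token).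
[cite: Kottwitz1986, §3] -/
theorem dep_root_eq_of_eigenframe_of_hdep (hϖ : Valued.v ϖ = WithZero.exp (-1 : ℤ))
    {γ : unitaryGroupOfForm σ ((StdForm.antidiagonal 3).over K)} (hγ0 : γ ∈ unitaryInt σ ((StdForm.antidiagonal 3).over K))
    (A : GL (Fin 3) K) (hA : IsIntMatrix (A : Matrix (Fin 3) (Fin 3) K)) (hA' : IsIntMatrix ((A⁻¹ : GL (Fin 3) K) : Matrix (Fin 3) (Fin 3) K))
    (s : Fin 3 → K) (hγA : ((γ : GL (Fin 3) K) : Matrix (Fin 3) (Fin 3) K) = (A : Matrix (Fin 3) (Fin 3) K) * Matrix.diagonal s * ((A⁻¹ : GL (Fin 3) K) : Matrix (Fin 3) (Fin 3) K))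
    {d₀ : ℕ} (he : ∀ i, Valued.v (s i - 1) ≤ Valued.v ϖ ^ d₀)
    {dep : {M : Submodule 𝒪[K] (Fin 3 → K) // IsVertex σ ϖ ((StdForm.antidiagonal 3).over K) M} → ℕ}
    (hdep : ∀ w : {M : Submodule 𝒪[K] (Fin 3 → K) // IsVertex σ ϖ ((StdForm.antidiagonal 3).over K) M}, latticeGraphIso σ ϖ ((StdForm.antidiagonal 3).over K) γ w = w →
      ∀ e, e ≤ dep w ↔ e ≤ d₀ ∧ w.1.map ((Matrix.toLin' (((γ : GL (Fin 3) K) : Matrix (Fin 3) (Fin 3) K) - 1)).restrictScalars 𝒪[K]) ≤ scaleLattice (ϖ ^ e) w.1) :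
    dep ⟨stdLattice K 3, 0, isSelfDualLattice_stdLattice_three_of_v hϖ⟩ = d₀ :=
  have hrfix := latticeGraphIso_root_eq_of_mem_unitaryInt hϖ hγ0
  le_antisymm (dep_le_cap_of_hdep hdep hrfix) ((hdep _ hrfix d₀).2 ⟨le_rfl, lev_root_pow_of_eigenframe hϖ A hA hA' s hγA he⟩)

/-- **`r₀ ∈ R`** (the engine's `hrR`): the root is fixed (`γ ∈ K₀`), self-dual (★ `isSelfDualLattice_stdLattice_three_of_v`) and of level `ϖ^{d₀}` (§3 root token).
[cite: Kottwitz1986, §3] [cite: BruhatTits1972, §10] -/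
theorem root_mem_rootRegion_of_eigenframe (hϖ : Valued.v ϖ = WithZero.exp (-1 : ℤ))
    {γ : unitaryGroupOfForm σ ((StdForm.antidiagonal 3).over K)} (hγ0 : γ ∈ unitaryInt σ ((StdForm.antidiagonal 3).over K))
    (A : GL (Fin 3) K) (hA : IsIntMatrix (A : Matrix (Fin 3) (Fin 3) K)) (hA' : IsIntMatrix ((A⁻¹ : GL (Fin 3) K) : Matrix (Fin 3) (Fin 3) K))
    (s : Fin 3 → K) (hγA : ((γ : GL (Fin 3) K) : Matrix (Fin 3) (Fin 3) K) = (A : Matrix (Fin 3) (Fin 3) K) * Matrix.diagonal s * ((A⁻¹ : GL (Fin 3) K) : Matrix (Fin 3) (Fin 3) K))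
    {d₀ : ℕ} (he : ∀ i, Valued.v (s i - 1) ≤ Valued.v ϖ ^ d₀)
    {R : Set {M : Submodule 𝒪[K] (Fin 3 → K) // IsVertex σ ϖ ((StdForm.antidiagonal 3).over K) M}}
    (hR : ∀ v, v ∈ R ↔ latticeGraphIso σ ϖ ((StdForm.antidiagonal 3).over K) γ v = v ∧ IsSelfDualLattice σ ϖ ((StdForm.antidiagonal 3).over K) v.1 ∧
      v.1.map ((Matrix.toLin' (((γ : GL (Fin 3) K) : Matrix (Fin 3) (Fin 3) K) - 1)).restrictScalars 𝒪[K]) ≤ scaleLattice (ϖ ^ d₀) v.1) :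
    (⟨stdLattice K 3, 0, isSelfDualLattice_stdLattice_three_of_v hϖ⟩ : {M : Submodule 𝒪[K] (Fin 3 → K) // IsVertex σ ϖ ((StdForm.antidiagonal 3).over K) M}) ∈ R :=
  (hR _).2 ⟨latticeGraphIso_root_eq_of_mem_unitaryInt hϖ hγ0, isSelfDualLattice_stdLattice_three_of_v hϖ, lev_root_pow_of_eigenframe hϖ A hA hA' s hγA he⟩

/-! ## §4 The cap is invisible in the isoceles configuration (any cap `B ≥ d₀`) -/

/-- **ANY LEVEL EXPONENT IS AT MOST `d₀`** (isoceles configuration, every vertex `w`, fixed or not): `LEV[w](ϖ^e) ⇒ e ≤ d₀` — otherwise monotonicity (★ `lev_mono_of_le`)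
would give `LEV[w](ϖ^{d₀+1})`, against ★ «nobody deeper» `not_map_sub_one_le_scaleLattice_pow_succ_of_isoceles`. [cite: Kottwitz1986, §3] [cite: Rogawski1990, §4.9 pp. 54–56] -/
theorem le_of_lev_pow_of_isoceles (hϖ : Valued.v ϖ = WithZero.exp (-1 : ℤ)) (h2 : Valued.v (2 : K) = 1)
    {γ : unitaryGroupOfForm σ ((StdForm.antidiagonal 3).over K)} (A : GL (Fin 3) K) (s : Fin 3 → K) (hs1 : s 1 = 1)
    (hγA : ((γ : GL (Fin 3) K) : Matrix (Fin 3) (Fin 3) K) = (A : Matrix (Fin 3) (Fin 3) K) * Matrix.diagonal s * ((A⁻¹ : GL (Fin 3) K) : Matrix (Fin 3) (Fin 3) K))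
    (i₀ : Fin 3) {d₀ : ℕ} (hiso : ∀ j, j ≠ i₀ → Valued.v (s i₀ - s j) = Valued.v ϖ ^ d₀) (hclose : ∀ j k, j ≠ i₀ → k ≠ i₀ → Valued.v (s j - s k) ≤ Valued.v ϖ ^ (d₀ + 2))
    (w : {M : Submodule 𝒪[K] (Fin 3 → K) // IsVertex σ ϖ ((StdForm.antidiagonal 3).over K) M}) {e : ℕ}
    (hlev : w.1.map ((Matrix.toLin' (((γ : GL (Fin 3) K) : Matrix (Fin 3) (Fin 3) K) - 1)).restrictScalars 𝒪[K]) ≤ scaleLattice (ϖ ^ e) w.1) :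
    e ≤ d₀ := by
  by_contra h
  have hϖ1 : Valued.v ϖ ≤ 1 := by rw [hϖ, ← WithZero.exp_zero]; exact WithZero.exp_le_exp.2 (by norm_num)
  exact not_map_sub_one_le_scaleLattice_pow_succ_of_isoceles hϖ h2 A s hs1 hγA i₀ hiso hclose w (lev_mono_of_le hϖ1 (by omega) hlev)

/-- **THE DEPTH NEVER EXCEEDS `d₀`, WHATEVER THE CAP** (isoceles configuration, `hdep` at ANY cap `B`): `dep w ≤ d₀` at every fixed vertex (`LEV[w](ϖ^{dep w})` by ★
`lev_pow_of_le_dep`, then `le_of_lev_pow_of_isoceles`). [cite: Kottwitz1986, §3] [cite: Rogawski1990, §4.9 pp. 54–56] -/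
theorem dep_le_of_isoceles (hϖ : Valued.v ϖ = WithZero.exp (-1 : ℤ)) (h2 : Valued.v (2 : K) = 1)
    {γ : unitaryGroupOfForm σ ((StdForm.antidiagonal 3).over K)} (A : GL (Fin 3) K) (s : Fin 3 → K) (hs1 : s 1 = 1)
    (hγA : ((γ : GL (Fin 3) K) : Matrix (Fin 3) (Fin 3) K) = (A : Matrix (Fin 3) (Fin 3) K) * Matrix.diagonal s * ((A⁻¹ : GL (Fin 3) K) : Matrix (Fin 3) (Fin 3) K))
    (i₀ : Fin 3) {d₀ : ℕ} (hiso : ∀ j, j ≠ i₀ → Valued.v (s i₀ - s j) = Valued.v ϖ ^ d₀) (hclose : ∀ j k, j ≠ i₀ → k ≠ i₀ → Valued.v (s j - s k) ≤ Valued.v ϖ ^ (d₀ + 2))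
    {B : ℕ} {dep : {M : Submodule 𝒪[K] (Fin 3 → K) // IsVertex σ ϖ ((StdForm.antidiagonal 3).over K) M} → ℕ}
    (hdep : ∀ w : {M : Submodule 𝒪[K] (Fin 3 → K) // IsVertex σ ϖ ((StdForm.antidiagonal 3).over K) M}, latticeGraphIso σ ϖ ((StdForm.antidiagonal 3).over K) γ w = w →
      ∀ e, e ≤ dep w ↔ e ≤ B ∧ w.1.map ((Matrix.toLin' (((γ : GL (Fin 3) K) : Matrix (Fin 3) (Fin 3) K) - 1)).restrictScalars 𝒪[K]) ≤ scaleLattice (ϖ ^ e) w.1)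
    {w : {M : Submodule 𝒪[K] (Fin 3 → K) // IsVertex σ ϖ ((StdForm.antidiagonal 3).over K) M}} (hw : latticeGraphIso σ ϖ ((StdForm.antidiagonal 3).over K) γ w = w) :
    dep w ≤ d₀ :=
  le_of_lev_pow_of_isoceles hϖ h2 A s hs1 hγA i₀ hiso hclose w (lev_pow_of_le_dep hdep hw le_rfl)

/-- **THE CAP-FREE DEPTH DICTIONARY** (isoceles configuration, `hdep` at any cap `B ≥ d₀`): at every fixed vertex `e ≤ dep w ↔ LEV[w](ϖ^e)` — the junction's
`Nat.findGreatest … B` never truncates. [cite: Kottwitz1986, §3] [cite: Rogawski1990, §4.9 pp. 54–56] -/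
theorem le_dep_iff_lev_of_isoceles (hϖ : Valued.v ϖ = WithZero.exp (-1 : ℤ)) (h2 : Valued.v (2 : K) = 1)
    {γ : unitaryGroupOfForm σ ((StdForm.antidiagonal 3).over K)} (A : GL (Fin 3) K) (s : Fin 3 → K) (hs1 : s 1 = 1)
    (hγA : ((γ : GL (Fin 3) K) : Matrix (Fin 3) (Fin 3) K) = (A : Matrix (Fin 3) (Fin 3) K) * Matrix.diagonal s * ((A⁻¹ : GL (Fin 3) K) : Matrix (Fin 3) (Fin 3) K))
    (i₀ : Fin 3) {d₀ : ℕ} (hiso : ∀ j, j ≠ i₀ → Valued.v (s i₀ - s j) = Valued.v ϖ ^ d₀) (hclose : ∀ j k, j ≠ i₀ → k ≠ i₀ → Valued.v (s j - s k) ≤ Valued.v ϖ ^ (d₀ + 2))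
    {B : ℕ} (hBd : d₀ ≤ B) {dep : {M : Submodule 𝒪[K] (Fin 3 → K) // IsVertex σ ϖ ((StdForm.antidiagonal 3).over K) M} → ℕ}
    (hdep : ∀ w : {M : Submodule 𝒪[K] (Fin 3 → K) // IsVertex σ ϖ ((StdForm.antidiagonal 3).over K) M}, latticeGraphIso σ ϖ ((StdForm.antidiagonal 3).over K) γ w = w →
      ∀ e, e ≤ dep w ↔ e ≤ B ∧ w.1.map ((Matrix.toLin' (((γ : GL (Fin 3) K) : Matrix (Fin 3) (Fin 3) K) - 1)).restrictScalars 𝒪[K]) ≤ scaleLattice (ϖ ^ e) w.1)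
    {w : {M : Submodule 𝒪[K] (Fin 3 → K) // IsVertex σ ϖ ((StdForm.antidiagonal 3).over K) M}} (hw : latticeGraphIso σ ϖ ((StdForm.antidiagonal 3).over K) γ w = w) (e : ℕ) :
    e ≤ dep w ↔ w.1.map ((Matrix.toLin' (((γ : GL (Fin 3) K) : Matrix (Fin 3) (Fin 3) K) - 1)).restrictScalars 𝒪[K]) ≤ scaleLattice (ϖ ^ e) w.1 :=
  ⟨fun h => ((hdep w hw e).1 h).2, fun h => (hdep w hw e).2 ⟨(le_of_lev_pow_of_isoceles hϖ h2 A s hs1 hγA i₀ hiso hclose w h).trans hBd, h⟩⟩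

/-- **`dep` IS THE EXACT DEPTH** (isoceles configuration, `hdep` at any cap `B ≥ d₀`): at every fixed vertex `¬LEV[w](ϖ^{dep w + 1})` (with ★ `lev_pow_of_le_dep`:
`LEV[w](ϖ^{dep w})`). [cite: Kottwitz1986, §3] [cite: Rogawski1990, §4.9 pp. 54–56] -/
theorem not_lev_dep_succ_of_isoceles (hϖ : Valued.v ϖ = WithZero.exp (-1 : ℤ)) (h2 : Valued.v (2 : K) = 1)
    {γ : unitaryGroupOfForm σ ((StdForm.antidiagonal 3).over K)} (A : GL (Fin 3) K) (s : Fin 3 → K) (hs1 : s 1 = 1)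
    (hγA : ((γ : GL (Fin 3) K) : Matrix (Fin 3) (Fin 3) K) = (A : Matrix (Fin 3) (Fin 3) K) * Matrix.diagonal s * ((A⁻¹ : GL (Fin 3) K) : Matrix (Fin 3) (Fin 3) K))
    (i₀ : Fin 3) {d₀ : ℕ} (hiso : ∀ j, j ≠ i₀ → Valued.v (s i₀ - s j) = Valued.v ϖ ^ d₀) (hclose : ∀ j k, j ≠ i₀ → k ≠ i₀ → Valued.v (s j - s k) ≤ Valued.v ϖ ^ (d₀ + 2))
    {B : ℕ} (hBd : d₀ ≤ B) {dep : {M : Submodule 𝒪[K] (Fin 3 → K) // IsVertex σ ϖ ((StdForm.antidiagonal 3).over K) M} → ℕ}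
    (hdep : ∀ w : {M : Submodule 𝒪[K] (Fin 3 → K) // IsVertex σ ϖ ((StdForm.antidiagonal 3).over K) M}, latticeGraphIso σ ϖ ((StdForm.antidiagonal 3).over K) γ w = w →
      ∀ e, e ≤ dep w ↔ e ≤ B ∧ w.1.map ((Matrix.toLin' (((γ : GL (Fin 3) K) : Matrix (Fin 3) (Fin 3) K) - 1)).restrictScalars 𝒪[K]) ≤ scaleLattice (ϖ ^ e) w.1)
    {w : {M : Submodule 𝒪[K] (Fin 3 → K) // IsVertex σ ϖ ((StdForm.antidiagonal 3).over K) M}} (hw : latticeGraphIso σ ϖ ((StdForm.antidiagonal 3).over K) γ w = w) :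
    ¬ w.1.map ((Matrix.toLin' (((γ : GL (Fin 3) K) : Matrix (Fin 3) (Fin 3) K) - 1)).restrictScalars 𝒪[K]) ≤ scaleLattice (ϖ ^ (dep w + 1)) w.1 := by
  intro h
  have : dep w + 1 ≤ dep w := (le_dep_iff_lev_of_isoceles hϖ h2 A s hs1 hγA i₀ hiso hclose hBd hdep hw (dep w + 1)).2 h
  omega

/-- **CAP CHANGE `B ↦ d₀`** (isoceles configuration): the junction's `hdep` at ANY cap `B ≥ d₀` implies `hdep` at the cap `d₀` — so the cap-`d₀` lemmas of §2–§3 apply to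
a depth encoded with a larger cap (e.g. the equilateral-style `B := N`). [cite: Kottwitz1986, §3] -/
theorem hdep_cap_of_isoceles (hϖ : Valued.v ϖ = WithZero.exp (-1 : ℤ)) (h2 : Valued.v (2 : K) = 1)
    {γ : unitaryGroupOfForm σ ((StdForm.antidiagonal 3).over K)} (A : GL (Fin 3) K) (s : Fin 3 → K) (hs1 : s 1 = 1)
    (hγA : ((γ : GL (Fin 3) K) : Matrix (Fin 3) (Fin 3) K) = (A : Matrix (Fin 3) (Fin 3) K) * Matrix.diagonal s * ((A⁻¹ : GL (Fin 3) K) : Matrix (Fin 3) (Fin 3) K))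
    (i₀ : Fin 3) {d₀ : ℕ} (hiso : ∀ j, j ≠ i₀ → Valued.v (s i₀ - s j) = Valued.v ϖ ^ d₀) (hclose : ∀ j k, j ≠ i₀ → k ≠ i₀ → Valued.v (s j - s k) ≤ Valued.v ϖ ^ (d₀ + 2))
    {B : ℕ} (hBd : d₀ ≤ B) {dep : {M : Submodule 𝒪[K] (Fin 3 → K) // IsVertex σ ϖ ((StdForm.antidiagonal 3).over K) M} → ℕ}
    (hdep : ∀ w : {M : Submodule 𝒪[K] (Fin 3 → K) // IsVertex σ ϖ ((StdForm.antidiagonal 3).over K) M}, latticeGraphIso σ ϖ ((StdForm.antidiagonal 3).over K) γ w = w →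
      ∀ e, e ≤ dep w ↔ e ≤ B ∧ w.1.map ((Matrix.toLin' (((γ : GL (Fin 3) K) : Matrix (Fin 3) (Fin 3) K) - 1)).restrictScalars 𝒪[K]) ≤ scaleLattice (ϖ ^ e) w.1) :
    ∀ w : {M : Submodule 𝒪[K] (Fin 3 → K) // IsVertex σ ϖ ((StdForm.antidiagonal 3).over K) M}, latticeGraphIso σ ϖ ((StdForm.antidiagonal 3).over K) γ w = w →
      ∀ e, e ≤ dep w ↔ e ≤ d₀ ∧ w.1.map ((Matrix.toLin' (((γ : GL (Fin 3) K) : Matrix (Fin 3) (Fin 3) K) - 1)).restrictScalars 𝒪[K]) ≤ scaleLattice (ϖ ^ e) w.1 := by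
  intro w hw e
  rw [le_dep_iff_lev_of_isoceles hϖ h2 A s hs1 hγA i₀ hiso hclose hBd hdep hw e]
  exact ⟨fun h => ⟨le_of_lev_pow_of_isoceles hϖ h2 A s hs1 hγA i₀ hiso hclose w h, h⟩, fun h => h.2⟩

/-! ## §5 The pack -/

/-- **THE «REGION FACTS» PACK** (F0P3a-p04 (g19)'s offer (b); the engine ED. 3 region binders `hrR hRF hRS hRdep` and the depth dictionary on ∕ off the region, in ONE
statement).  Isoceles eigen-data `γ = A·diag(s)·A⁻¹` (`A, A⁻¹` integral, `s 1 = 1`, `|s_i − 1| ≤ |ϖ|^{d₀}`, isolated `i₀`, close pair, `3 ≤ d₀`), `γ ∈ K₀`, `|2| = 1`; the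
junction's `dep` with `hdep` at ANY cap `B ≥ d₀` (`hBd`; `B := d₀` is `le_rfl`); `R = {fix ∧ SD ∧ LEV(ϖ^{d₀})}` through `hR`.  THEN: (1) `r₀ ∈ R`; (2) `R ⊆ F`; (3) `SD` on
`R`; (4) `dep = d₀` on `R`; (5) `2 ≤ dep` on `R`; (6) every fixed vertex has `dep ≤ d₀` (★ «nobody deeper»); (7) the cap-free dictionary `e ≤ dep w ↔ LEV[w](ϖ^e)` at
every fixed `w`; (8) `¬LEV[w](ϖ^{dep w + 1})` at every fixed `w` (`dep` is the exact depth); (9) a fixed self-dual vertex is in `R` iff `dep = d₀`; (10) off `R` its depth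
is `< d₀` (the `dep v < D`, `D := d₀`, antecedent of the L3 gen-form rows).
[cite: Kottwitz1986, §3] [cite: Rogawski1990, §4.9 pp. 54–56] [cite: Serre1980Trees, II.1.1] [cite: BruhatTits1972, §10] -/
theorem rootRegion_facts_of_isoceles (hϖ : Valued.v ϖ = WithZero.exp (-1 : ℤ)) (h2 : Valued.v (2 : K) = 1)
    {γ : unitaryGroupOfForm σ ((StdForm.antidiagonal 3).over K)} (hγ0 : γ ∈ unitaryInt σ ((StdForm.antidiagonal 3).over K))
    (A : GL (Fin 3) K) (hA : IsIntMatrix (A : Matrix (Fin 3) (Fin 3) K)) (hA' : IsIntMatrix ((A⁻¹ : GL (Fin 3) K) : Matrix (Fin 3) (Fin 3) K))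
    (s : Fin 3 → K) (hs1 : s 1 = 1)
    (hγA : ((γ : GL (Fin 3) K) : Matrix (Fin 3) (Fin 3) K) = (A : Matrix (Fin 3) (Fin 3) K) * Matrix.diagonal s * ((A⁻¹ : GL (Fin 3) K) : Matrix (Fin 3) (Fin 3) K))
    (i₀ : Fin 3) {d₀ : ℕ} (hd3 : 3 ≤ d₀) (he : ∀ i, Valued.v (s i - 1) ≤ Valued.v ϖ ^ d₀)
    (hiso : ∀ j, j ≠ i₀ → Valued.v (s i₀ - s j) = Valued.v ϖ ^ d₀) (hclose : ∀ j k, j ≠ i₀ → k ≠ i₀ → Valued.v (s j - s k) ≤ Valued.v ϖ ^ (d₀ + 2))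
    {B : ℕ} (hBd : d₀ ≤ B) (dep : {M : Submodule 𝒪[K] (Fin 3 → K) // IsVertex σ ϖ ((StdForm.antidiagonal 3).over K) M} → ℕ)
    (hdep : ∀ w : {M : Submodule 𝒪[K] (Fin 3 → K) // IsVertex σ ϖ ((StdForm.antidiagonal 3).over K) M}, latticeGraphIso σ ϖ ((StdForm.antidiagonal 3).over K) γ w = w →
      ∀ e, e ≤ dep w ↔ e ≤ B ∧ w.1.map ((Matrix.toLin' (((γ : GL (Fin 3) K) : Matrix (Fin 3) (Fin 3) K) - 1)).restrictScalars 𝒪[K]) ≤ scaleLattice (ϖ ^ e) w.1)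
    (R : Set {M : Submodule 𝒪[K] (Fin 3 → K) // IsVertex σ ϖ ((StdForm.antidiagonal 3).over K) M})
    (hR : ∀ v, v ∈ R ↔ latticeGraphIso σ ϖ ((StdForm.antidiagonal 3).over K) γ v = v ∧ IsSelfDualLattice σ ϖ ((StdForm.antidiagonal 3).over K) v.1 ∧
      v.1.map ((Matrix.toLin' (((γ : GL (Fin 3) K) : Matrix (Fin 3) (Fin 3) K) - 1)).restrictScalars 𝒪[K]) ≤ scaleLattice (ϖ ^ d₀) v.1) :
    (⟨stdLattice K 3, 0, isSelfDualLattice_stdLattice_three_of_v hϖ⟩ : {M : Submodule 𝒪[K] (Fin 3 → K) // IsVertex σ ϖ ((StdForm.antidiagonal 3).over K) M}) ∈ R ∧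
    R ⊆ {v | latticeGraphIso σ ϖ ((StdForm.antidiagonal 3).over K) γ v = v} ∧
    (∀ v ∈ R, IsSelfDualLattice σ ϖ ((StdForm.antidiagonal 3).over K) v.1) ∧
    (∀ v ∈ R, dep v = d₀) ∧
    (∀ v ∈ R, 2 ≤ dep v) ∧
    (∀ w : {M : Submodule 𝒪[K] (Fin 3 → K) // IsVertex σ ϖ ((StdForm.antidiagonal 3).over K) M}, latticeGraphIso σ ϖ ((StdForm.antidiagonal 3).over K) γ w = w → dep w ≤ d₀) ∧
    (∀ w : {M : Submodule 𝒪[K] (Fin 3 → K) // IsVertex σ ϖ ((StdForm.antidiagonal 3).over K) M}, latticeGraphIso σ ϖ ((StdForm.antidiagonal 3).over K) γ w = w →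
      ∀ e, e ≤ dep w ↔ w.1.map ((Matrix.toLin' (((γ : GL (Fin 3) K) : Matrix (Fin 3) (Fin 3) K) - 1)).restrictScalars 𝒪[K]) ≤ scaleLattice (ϖ ^ e) w.1) ∧
    (∀ w : {M : Submodule 𝒪[K] (Fin 3 → K) // IsVertex σ ϖ ((StdForm.antidiagonal 3).over K) M}, latticeGraphIso σ ϖ ((StdForm.antidiagonal 3).over K) γ w = w →
      ¬ w.1.map ((Matrix.toLin' (((γ : GL (Fin 3) K) : Matrix (Fin 3) (Fin 3) K) - 1)).restrictScalars 𝒪[K]) ≤ scaleLattice (ϖ ^ (dep w + 1)) w.1) ∧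
    (∀ w : {M : Submodule 𝒪[K] (Fin 3 → K) // IsVertex σ ϖ ((StdForm.antidiagonal 3).over K) M}, latticeGraphIso σ ϖ ((StdForm.antidiagonal 3).over K) γ w = w →
      IsSelfDualLattice σ ϖ ((StdForm.antidiagonal 3).over K) w.1 → (w ∈ R ↔ dep w = d₀)) ∧
    (∀ w : {M : Submodule 𝒪[K] (Fin 3 → K) // IsVertex σ ϖ ((StdForm.antidiagonal 3).over K) M}, latticeGraphIso σ ϖ ((StdForm.antidiagonal 3).over K) γ w = w →
      IsSelfDualLattice σ ϖ ((StdForm.antidiagonal 3).over K) w.1 → w ∉ R → dep w < d₀) := by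
  -- the cap change `B ↦ d₀` (★ «nobody deeper»), then the cap-`d₀` facts of §2–§3
  have hdep₀ := hdep_cap_of_isoceles hϖ h2 A s hs1 hγA i₀ hiso hclose hBd hdep
  exact ⟨root_mem_rootRegion_of_eigenframe hϖ hγ0 A hA hA' s hγA he hR,
    rootRegion_subset_fixed hR,
    fun _ hv => isSelfDualLattice_of_mem_rootRegion hR hv,
    fun _ hv => dep_eq_of_mem_rootRegion_of_hdep hdep₀ hR hv,
    fun _ hv => by rw [dep_eq_of_mem_rootRegion_of_hdep hdep₀ hR hv]; omega,
    fun _ hw => dep_le_of_isoceles hϖ h2 A s hs1 hγA i₀ hiso hclose hdep hw,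
    fun _ hw e => le_dep_iff_lev_of_isoceles hϖ h2 A s hs1 hγA i₀ hiso hclose hBd hdep hw e,
    fun _ hw => not_lev_dep_succ_of_isoceles hϖ h2 A s hs1 hγA i₀ hiso hclose hBd hdep hw,
    fun _ hw hwS => mem_rootRegion_iff_dep_eq_of_hdep hdep₀ hR hw hwS,
    fun _ hw hwS hwR => dep_lt_of_not_mem_rootRegion_of_hdep hdep₀ hR hw hwS hwR⟩

end Literature.NumberTheory.Automorphic.UnitaryLatticeTree

end
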